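import Mathlib
import HarnessLib
import Literature.Probability.MarkovChains.StationaryPerturbation

/-!
# LatticeQCDFlow / Exactness — an accept step evaluated with a bounded error biases the
# stationary law to FIRST ORDER in the error (the Lean face of R2-SCOPE §3 E5 / E4 / X-5c)

HONEST FRAMING: exact (Metropolis-corrected) sampling algorithms for lattice gauge theory;
figures of merit are autocorrelation/cost numbers at stated couplings and volumes; no
continuum-physics claim.

Venture `LatticeQCDFlow` (cell pub-lqcd), topic `Exactness`; FANOUT row 38 (r2-scope, gen 18).
NEW WORK of the cell (short corollaries of published results vendored in
`Literature/Probability/MarkovChains/{GroupInverse,ErgodicityCoefficient,StationaryPerturbation}.lean`),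
not itself a published statement.  Setting: a finite state space `X`, a proposal matrix `T ≥ 0` with
row sums `≤ 1`, and an accept/reject chain whose acceptance probability is the Metropolis function
`min(1, e^Δ)` of a log-ratio `Δ x y` (for HMC / flow-MCMC with fermions: `Δ = −δH`, or
`−ΔS_g + (pseudofermion action difference)`, each requiring linear solves).  If the IMPLEMENTED
accept step uses `Δ̂` with `|Δ̂ − Δ| ≤ η` everywhere (a solver run to a finite residual, a regulated
or truncated operator in the accept step — R2-SCOPE §3 E5, E4, §5 X-5c — or single precision),
then:

* `abs_min_one_exp_sub_le` — `s ↦ min(1, eˢ)` is 1-Lipschitz, so the acceptance probabilities move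
  by at most `η` (`abs_metropolisAccept_sub_le`);
* `rowDiff_metropolisKernel_le` — the kernel actually run is a perturbation of the exact one with
  `Σ_y |K̂ x y − K x y| ≤ 2η` for every `x` (Alquier–Friel–Everitt–Boland's kernel bound,
  `Literature…rowDiff_rateKernel_accept_le`);
* `tvDist_le_of_logRatio_error_of_doeblin` — if the EXACT chain has a Doeblin/Dobrushin constant
  `δ₀ > 0` (`τ(K) ≤ 1 − δ₀`; e.g. an independence flow sampler with bounded importance weights),
  the stationary law `π̂` of the chain actually run satisfies `‖π̂ − π‖_TV ≤ η / δ₀`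
  (Seneta 1988, `Literature…tvDist_le_div_of_ergodicCoeff_le`);
* `tvDist_le_of_logRatio_error` — for an irreducible exact chain, `‖π̂ − π‖_TV ≤ η · τ(Q#)` with
  Seneta's condition number of the EXACT chain (KN Thm 5.3.5 (a),
  `Literature…tvDist_le_mul_ergodicCoeff_groupInv`);
* `witness₂_*` — the bias is real and of first order: on `Fin 2` with `T ≡ ½`, `π` uniform (exact
  acceptance `≡ 1`) and ONE acceptance probability lowered from `1` to `4/5`, the chain run has
  stationary law `(5/9, 4/9)`, at total-variation distance `1/18` from `π` (the Doeblin bound gives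
  `1/5`).

So an accept-step defect is NOT averaged away (contrast the pseudo-marginal constructions of
`PseudoMarginal.lean`, which are exact): its stationary bias is linear in the defect with the exact
chain's own condition number as the constant — which is what the E5 residual threshold and the
§5.3 (V1-R2) detector thresholds of R2-SCOPE.md have to be sized against.  [folklore]-level
corollaries; the published ingredients are cited in the Literature files (Kirkland–Neumann 2012
§5.3; Seneta 1988 via Fasino–Tudisco 2020 Thm 2; Alquier et al. 2016 Cor. 2.3).  Nothing here is
specific to fermions or to lattice field theory; no threshold value is asserted.
-/

namespace Summit.Ventures.LatticeQCDFlow.Exactness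

open Finset Matrix Literature.Probability.MarkovChains

variable {X : Type*} [Fintype X] [DecidableEq X]

/-! ## The Metropolis function is 1-Lipschitz in the log-ratio -/

omit [Fintype X] [DecidableEq X] in
/-- For `a ≤ b ≤ 0`: `e^b − e^a ≤ b − a` (slope of `exp` below `0` is at most `1`). [folklore] -/
private theorem exp_sub_exp_le_sub {a b : ℝ} (hab : a ≤ b) (hb : b ≤ 0) :
    Real.exp b - Real.exp a ≤ b - a := by
  have h1 : Real.exp b ≤ 1 := Real.exp_le_one_iff.2 hb
  -- `1 − e^{a−b} ≤ b − a` from `1 + (a − b) ≤ e^{a−b}`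
  have h2 : 1 - Real.exp (a - b) ≤ b - a := by linarith [Real.add_one_le_exp (a - b)]
  have h3 : Real.exp b - Real.exp a = Real.exp b * (1 - Real.exp (a - b)) := by
    rw [mul_sub, mul_one, ← Real.exp_add]; ring_nf
  rw [h3]
  calc Real.exp b * (1 - Real.exp (a - b)) ≤ 1 * (1 - Real.exp (a - b)) :=
        mul_le_mul_of_nonneg_right h1 (by linarith [Real.exp_le_one_iff.2 (by linarith : a - b ≤ 0)])
    _ ≤ b - a := by linarith

omit [Fintype X] [DecidableEq X] in
/-- `min(1, eˢ) = e^{min(s,0)}`. [folklore] -/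
private theorem min_one_exp (s : ℝ) : min 1 (Real.exp s) = Real.exp (min s 0) := by
  rcases le_total s 0 with h | h
  · rw [min_eq_right (Real.exp_le_one_iff.2 h), min_eq_left h]
  · rw [min_eq_left (Real.one_le_exp_iff.2 h |> fun h' => h'), min_eq_right h, Real.exp_zero]

omit [Fintype X] [DecidableEq X] in
/-- **The Metropolis function `s ↦ min(1, eˢ)` is 1-Lipschitz.** [folklore] -/
theorem abs_min_one_exp_sub_le (s t : ℝ) :
    |min 1 (Real.exp s) - min 1 (Real.exp t)| ≤ |s - t| := by
  rw [min_one_exp, min_one_exp]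
  have key : ∀ a b : ℝ, a ≤ b → |Real.exp (min b 0) - Real.exp (min a 0)| ≤ |b - a| := by
    intro a b hab
    have hm : min a 0 ≤ min b 0 := min_le_min_right 0 hab
    rw [abs_of_nonneg (sub_nonneg.2 (Real.exp_le_exp.2 hm)), abs_of_nonneg (sub_nonneg.2 hab)]
    calc Real.exp (min b 0) - Real.exp (min a 0) ≤ min b 0 - min a 0 :=
          exp_sub_exp_le_sub hm (min_le_right _ _)
      _ ≤ b - a := by
          rcases le_total a 0 with ha | ha <;> rcases le_total b 0 with hb | hb
          · rw [min_eq_left ha, min_eq_left hb]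
          · rw [min_eq_left ha, min_eq_right hb]; linarith
          · rw [min_eq_right ha, min_eq_left hb]; linarith
          · rw [min_eq_right ha, min_eq_right hb]; linarith
  rcases le_total s t with h | h
  · rw [abs_sub_comm, abs_sub_comm s t]; exact key s t h
  · exact key t s h

/-- The Metropolis acceptance probability built from a log-ratio `Δ`:
`metropolisAccept Δ x y = min(1, e^{Δ x y})`. [folklore] -/
noncomputable def metropolisAccept (Δ : X → X → ℝ) : X → X → ℝ :=
  fun x y => min 1 (Real.exp (Δ x y))

omit [Fintype X] [DecidableEq X] in
/-- `0 ≤ min(1, e^Δ) ≤ 1`. [folklore] -/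
theorem metropolisAccept_mem (Δ : X → X → ℝ) (x y : X) :
    0 ≤ metropolisAccept Δ x y ∧ metropolisAccept Δ x y ≤ 1 :=
  ⟨le_min zero_le_one (Real.exp_pos _).le, min_le_left _ _⟩

omit [Fintype X] [DecidableEq X] in
/-- A log-ratio error of at most `η` moves the acceptance probability by at most `η`. [folklore] -/
theorem abs_metropolisAccept_sub_le {Δ Δ' : X → X → ℝ} {η : ℝ} (h : ∀ x y, |Δ' x y - Δ x y| ≤ η)
    (x y : X) : |metropolisAccept Δ' x y - metropolisAccept Δ x y| ≤ η :=
  (abs_min_one_exp_sub_le _ _).trans (h x y)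

/-! ## The chain actually run is a perturbation of size `2η` -/

/-- The accept/reject kernel with proposal `T` and Metropolis acceptance from the log-ratio `Δ`.
[folklore] -/
noncomputable def metropolisKernel (T Δ : X → X → ℝ) : Matrix X X ℝ :=
  rateKernel fun x y => T x y * metropolisAccept Δ x y

/-- Such a kernel is row-stochastic for `T ≥ 0` with row sums `≤ 1`. [folklore] -/
theorem metropolisKernel_isRowStochastic {T : X → X → ℝ} (hT0 : ∀ x y, 0 ≤ T x y)
    (hT1 : ∀ x, ∑ y, T x y ≤ 1) (Δ : X → X → ℝ) : IsRowStochastic (metropolisKernel T Δ) := by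
  refine ⟨fun x y => ?_, fun x => sum_rateKernel _ x⟩
  unfold metropolisKernel rateKernel
  split_ifs with h
  · have h1 : ∑ z ∈ univ.erase x, T x z * metropolisAccept Δ x z ≤ ∑ z, T x z :=
      (sum_le_sum_of_subset_of_nonneg (erase_subset _ _) fun z _ _ =>
        mul_nonneg (hT0 x z) (metropolisAccept_mem Δ x z).1).trans
        (sum_le_sum fun z _ => mul_le_of_le_one_right (hT0 x z) (metropolisAccept_mem Δ x z).2)
    linarith [hT1 x]
  · exact mul_nonneg (hT0 x y) (metropolisAccept_mem Δ x y).1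

/-- **E5, KERNEL FORM**: a log-ratio error `≤ η` in the accept step perturbs every row of the kernel
by at most `2η` in `ℓ¹`. [folklore] -/
theorem rowDiff_metropolisKernel_le {T : X → X → ℝ} (hT0 : ∀ x y, 0 ≤ T x y)
    (hT1 : ∀ x, ∑ y, T x y ≤ 1) {Δ Δ' : X → X → ℝ} {η : ℝ} (h : ∀ x y, |Δ' x y - Δ x y| ≤ η)
    (x : X) : ∑ y, |metropolisKernel T Δ' x y - metropolisKernel T Δ x y| ≤ 2 * η :=
  rowDiff_rateKernel_accept_le hT0 hT1 (abs_metropolisAccept_sub_le h) x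

/-! ## The stationary bias is first order in `η` -/

/-- **E5 UNDER A DOEBLIN CONSTANT** (independence / flow samplers with bounded weights): if the exact
chain `K = metropolisKernel T Δ` has `τ(K) ≤ 1 − δ₀`, `δ₀ > 0`, and stationary distribution `π`,
then the stationary distribution `π̂` of the chain run with `|Δ̂ − Δ| ≤ η` satisfies
`‖π̂ − π‖₁ ≤ 2η/δ₀` and `‖π̂ − π‖_TV ≤ η/δ₀`. [folklore] -/
theorem tvDist_le_of_logRatio_error_of_doeblin {T : X → X → ℝ} (hT0 : ∀ x y, 0 ≤ T x y)
    (hT1 : ∀ x, ∑ y, T x y ≤ 1) {Δ Δ' : X → X → ℝ} {η : ℝ} (h : ∀ x y, |Δ' x y - Δ x y| ≤ η)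
    {π π' : X → ℝ} (hπ1 : ∑ x, π x = 1) (hst : IsStationary π (metropolisKernel T Δ))
    (hπ'0 : ∀ x, 0 ≤ π' x) (hπ'1 : ∑ x, π' x = 1) (hst' : IsStationary π' (metropolisKernel T Δ'))
    {δ₀ : ℝ} (hδ₀ : 0 < δ₀) (hτ : ergodicCoeff (metropolisKernel T Δ) ≤ 1 - δ₀) :
    ∑ y, |π' y - π y| ≤ 2 * η / δ₀ ∧ tvDist π' π ≤ η / δ₀ := by
  have h2 := tvDist_le_div_of_ergodicCoeff_le hπ1 hst hπ'0 hπ'1 hst' hδ₀ hτ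
    (rowDiff_metropolisKernel_le hT0 hT1 h)
  refine ⟨h2.1, ?_⟩
  have h3 : 2 * η / (2 * δ₀) = η / δ₀ := by
    rw [mul_div_mul_left _ _ (two_ne_zero)]
  rw [← h3]
  exact h2.2

/-- **E5 WITH THE GROUP INVERSE** (any irreducible exact chain): `‖π̂ − π‖_TV ≤ η · τ(Q#)`,
`Q# = (I − K)#` the group inverse of the EXACT chain (Seneta's condition number, KN Thm 5.3.5 (a)).
[folklore] -/
theorem tvDist_le_of_logRatio_error {T : X → X → ℝ} (hT0 : ∀ x y, 0 ≤ T x y)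
    (hT1 : ∀ x, ∑ y, T x y ≤ 1) {Δ Δ' : X → X → ℝ} {η : ℝ} (h : ∀ x y, |Δ' x y - Δ x y| ≤ η)
    {π π' : X → ℝ} (hπ1 : ∑ x, π x = 1) (hst : IsStationary π (metropolisKernel T Δ))
    (hirr : Literature.Probability.MarkovChains.IsIrreducible (metropolisKernel T Δ))
    (hπ'0 : ∀ x, 0 ≤ π' x) (hπ'1 : ∑ x, π' x = 1) (hst' : IsStationary π' (metropolisKernel T Δ')) :
    tvDist π' π ≤ η * ergodicCoeff (groupInv π (metropolisKernel T Δ)) := by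
  have hK := metropolisKernel_isRowStochastic hT0 hT1 Δ
  have h2 := tvDist_le_mul_ergodicCoeff_groupInv hK hπ1 hst (isUnit_fundamentalInv hπ1 hK hst hirr)
    hπ'0 hπ'1 hst' (rowDiff_metropolisKernel_le hT0 hT1 h)
  have h3 : 2 * η / 2 = η := by ring
  rw [h3] at h2
  exact h2

/-! ## Witness: the bias is real and of first order (two states) -/

/-- Proposal `T ≡ ½` on two states. [folklore] -/
noncomputable def T₂half : Fin 2 → Fin 2 → ℝ := fun _ _ => 1 / 2

/-- The exact acceptance for the uniform target with the symmetric proposal `T₂half` is `≡ 1`;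
the PERTURBED acceptance lowers the single entry `0 → 1` to `4/5` (defect `1/5`). [folklore] -/
noncomputable def acc₂pert : Fin 2 → Fin 2 → ℝ := fun x y => if x = 0 ∧ y = 1 then 4 / 5 else 1

/-- The chain actually run. [folklore] -/
noncomputable def K₂pert : Matrix (Fin 2) (Fin 2) ℝ := rateKernel fun x y => T₂half x y * acc₂pert x y

/-- The exact chain (acceptance `≡ 1`). [folklore] -/
noncomputable def K₂exact : Matrix (Fin 2) (Fin 2) ℝ := rateKernel fun x y => T₂half x y * 1

/-- Entries of the chain run: `((3/5, 2/5), (1/2, 1/2))`. [folklore] -/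
theorem K₂pert_entries :
    K₂pert 0 0 = 3 / 5 ∧ K₂pert 0 1 = 2 / 5 ∧ K₂pert 1 0 = 1 / 2 ∧ K₂pert 1 1 = 1 / 2 := by
  have hu : (univ : Finset (Fin 2)) = {0, 1} := by decide
  simp only [K₂pert, rateKernel, T₂half, acc₂pert, hu]
  norm_num

/-- Entries of the exact chain: all `1/2` (independent sampling of the uniform law). [folklore] -/
theorem K₂exact_entries :
    K₂exact 0 0 = 1 / 2 ∧ K₂exact 0 1 = 1 / 2 ∧ K₂exact 1 0 = 1 / 2 ∧ K₂exact 1 1 = 1 / 2 := by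
  have hu : (univ : Finset (Fin 2)) = {0, 1} := by decide
  simp only [K₂exact, rateKernel, T₂half, hu]
  norm_num

/-- The uniform law is stationary for the exact chain. [folklore] -/
theorem witness₂_exact_stationary : IsStationary (![1 / 2, 1 / 2] : Fin 2 → ℝ) K₂exact := by
  obtain ⟨h00, h01, h10, h11⟩ := K₂exact_entries
  intro y
  fin_cases y <;> simp [Fin.sum_univ_two, h00, h01, h10, h11] <;> norm_num

/-- The law `(5/9, 4/9)` is stationary for the chain actually run. [folklore] -/
theorem witness₂_pert_stationary : IsStationary (![5 / 9, 4 / 9] : Fin 2 → ℝ) K₂pert := by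
  obtain ⟨h00, h01, h10, h11⟩ := K₂pert_entries
  intro y
  fin_cases y <;> simp [Fin.sum_univ_two, h00, h01, h10, h11] <;> norm_num

/-- The acceptance defect is `1/5` (and the log-ratio defect `log(5/4) < 1/4`). [folklore] -/
theorem witness₂_defect : ∀ x y : Fin 2, |acc₂pert x y - 1| ≤ 1 / 5 := by
  intro x y
  fin_cases x <;> fin_cases y <;> norm_num [acc₂pert]

/-- **THE BIAS**: `‖(5/9, 4/9) − (1/2, 1/2)‖_TV = 1/18 > 0` — an accept-step defect of `1/5` in ONE
acceptance probability moves the stationary law by `1/18` in total variation (the Doeblin bound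
of `tvDist_le_div_of_ergodicCoeff_le` with `‖E‖_∞ ≤ 2/5`, `δ₀ = 1` gives `1/5`). [folklore] -/
theorem witness₂_tvDist :
    tvDist (![5 / 9, 4 / 9] : Fin 2 → ℝ) ![1 / 2, 1 / 2] = 1 / 18 := by
  simp [tvDist, Fin.sum_univ_two]
  norm_num [abs_of_pos, abs_of_neg]

/-- The exact chain here is independent sampling: `τ(K) = 0 ≤ 1 − 1`, so the Doeblin form of the
bound applies with `δ₀ = 1` and yields `‖π̂ − π‖_TV ≤ (2/5)/(2·1) = 1/5` against the true `1/18`.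
[folklore] -/
theorem witness₂_bound :
    tvDist (![5 / 9, 4 / 9] : Fin 2 → ℝ) ![1 / 2, 1 / 2] ≤ (2 / 5) / (2 * 1) := by
  have hτ : ergodicCoeff K₂exact ≤ 1 - 1 := by
    refine ergodicCoeff_le (by norm_num) fun i j => ?_
    obtain ⟨h00, h01, h10, h11⟩ := K₂exact_entries
    fin_cases i <;> fin_cases j <;> simp [Fin.sum_univ_two, h00, h01, h10, h11]
  have hE : ∀ x : Fin 2, ∑ y, |K₂pert x y - K₂exact x y| ≤ 2 / 5 := by
    obtain ⟨h00, h01, h10, h11⟩ := K₂pert_entries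
    obtain ⟨e00, e01, e10, e11⟩ := K₂exact_entries
    intro x
    fin_cases x <;> simp [Fin.sum_univ_two, h00, h01, h10, h11, e00, e01, e10, e11] <;> norm_num [abs_of_pos, abs_of_neg]
  exact (tvDist_le_div_of_ergodicCoeff_le (by simp [Fin.sum_univ_two]; norm_num)
    witness₂_exact_stationary (fun x => by fin_cases x <;> simp <;> norm_num)
    (by simp [Fin.sum_univ_two]; norm_num) witness₂_pert_stationary one_pos hτ hE).2

end Summit.Ventures.LatticeQCDFlow.Exactness
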